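import Summits.ResolutionOfSingularities.ResolutionOfSingularities.Theorems.ThinnessCutClasses
import HarnessLib

/-!
# ThinnessCutKernels — §§6–8 of lens-1 g12 «ThinnessCut» rev 3 (sha256 98f17d8edf72d004; critic row 86), VERBATIM

§6 THE LAW (PROVED; tree W4.1 budget by name): an eternal strict torsor run forces FINITE thinness —
`infiniteThinness_of_discrete`,
`zeno_vacuous_of_discrete`, `eternalLU_iff_zenoLU`.  §7 the kernel `luAlphaPTorsor_iff_thinnessCut :
Valuative.LuAlphaPTorsor ↔ StallStartLU ∧ ZenoLU`
and `luAlphaPTorsor_of_pieces`.  §8 the ORDER AXIS at the base (g11's `TameOrderCore` range re-derived at stage 0 with proofs):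
`div_pow_mem_blowupRing`, `exists_strictStep_of_mem_pow`, `canStep_of_mem_pow`, `orderOneAt_of_mem_of_not_mem_sq`,
the piece `TameStartLU`
[WEAKER · UNDECIDED · ATTACKABLE-L], `TameHyp`, `tameStartLU_iff`, `tameHyp_of_stalled`,
`stallStartLU_of_tameStartLU`, and the kernel on the order
axis `luAlphaPTorsor_iff_tameCut : 0641 ↔ TameStartLU ∧ ZenoLU`.  Module docstring of
`Theorems.ThinnessCutClasses` = the node.  [WRITER NOTE
(decomp-res writer g5): verbatim; `closes_tame` (route level) dropped.]  (Sources: Cossart2011; CossartPiltant2019;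
Kollar2007 Aside 3.57;
HeinzerEtAl2015; Matsumura1987; KnafKuhlmann2009.)
-/

namespace Summit.ResolutionOfSingularities.ResolutionOfSingularities.Theorems.ThinnessCutClasses

open IsLocalRing
open Literature.AlgebraicGeometry.Resolution
open Summit.ResolutionOfSingularities.ResolutionOfSingularities.Theses
open Summit.ResolutionOfSingularities.ResolutionOfSingularities.Theorems
open Summit.ResolutionOfSingularities.ResolutionOfSingularities.Theorems.SteerRankThinness
  (IsExcParam IsStrictStep IsTorsorRunUpTo IsTorsorRun InfiniteThinness not_isTorsorRun_of_infiniteThinness)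
open scoped IntermediateField

variable {K : Type} [Field K]

/-! ## 6. THE LAW: an eternal strict run forces finite thinness (PROVED; tree W4.1 budget by name) -/

/-- **Rung: a discrete rank-one valuation is infinitely thin along EVERY sequence of subrings** (no
hypothesis on `R`: exceptional parameters have value `< 1` by definition).  If the value group is generated
by `ν(π)` (`ν π < 1`), every exceptional parameter has value `≤ ν π`, so a product of `N` of them is
`≤ (ν π)^N`, eventually below any `ν y`, `y ≠ 0`.  Hence (with the law `eternalLU_iff_zenoLU`) the tree's
discrete theorem `PfaffLine.luAlphaPTorsor_of_discrete` lies on the NON-ETERNAL side and the side condition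
of `ZenoLU` is never met on a discrete valuation (`zeno_vacuous_of_discrete`). [folklore] -/
theorem infiniteThinness_of_discrete (O : ValuationSubring K) (R : ℕ → Subring K)
    (hdisc : ∃ π : K, π ≠ 0 ∧ O.valuation π < 1 ∧ ∀ z : K, z ≠ 0 → ∃ n : ℤ,
      O.valuation z = O.valuation π ^ n) :
    InfiniteThinness O R := by
  obtain ⟨π, hπ0, hπ1, hdisc⟩ := hdisc
  have hvπ0 : O.valuation π ≠ 0 := (Valuation.ne_zero_iff _).mpr hπ0
  -- every element of value `< 1` has value `≤ ν π`
  have hle : ∀ z : K, z ≠ 0 → O.valuation z < 1 → O.valuation z ≤ O.valuation π := by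
    intro z hz0 hz1
    obtain ⟨n, hn⟩ := hdisc z hz0
    rw [hn] at hz1 ⊢
    have hn1 : 1 ≤ n := by
      by_contra hlt
      push Not at hlt
      have : (1 : _) ≤ O.valuation π ^ n := by
        have h0 : n ≤ 0 := by omega
        calc (1 : _) = O.valuation π ^ (0 : ℤ) := (zpow_zero _).symm
          _ ≤ O.valuation π ^ n := zpow_le_zpow_right_of_le_one₀ (zero_lt_iff.mpr hvπ0) hπ1.le h0
      exact absurd hz1 (not_lt.mpr this)
    calc O.valuation π ^ n ≤ O.valuation π ^ (1 : ℤ) :=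
          zpow_le_zpow_right_of_le_one₀ (zero_lt_iff.mpr hvπ0) hπ1.le hn1
      _ = O.valuation π := zpow_one _
  -- products of `N` exceptional values are `≤ (ν π)^N`
  have hprod : ∀ (N : ℕ) (x : ℕ → K), (∀ i < N, IsExcParam O (R i) (x i)) →
      ∏ i ∈ Finset.range N, O.valuation (x i) ≤ O.valuation π ^ N := by
    intro N x hx
    calc ∏ i ∈ Finset.range N, O.valuation (x i) ≤ ∏ _i ∈ Finset.range N, O.valuation π :=
          Finset.prod_le_prod' fun i hi =>
            hle (x i) (hx i (Finset.mem_range.mp hi)).2.1 (hx i (Finset.mem_range.mp hi)).2.2.1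
      _ = O.valuation π ^ N := by rw [Finset.prod_const, Finset.card_range]
  intro y hy0
  obtain ⟨m, hm⟩ := hdisc y hy0
  -- choose `N` with `(ν π)^N < ν y = (ν π)^m`
  refine ⟨m.toNat + 1, fun x hx => lt_of_le_of_lt (hprod _ x hx) ?_⟩
  rw [hm]
  have hlt1 : O.valuation π ^ ((m.toNat : ℤ) + 1) < O.valuation π ^ m := by
    refine zpow_lt_zpow_right_of_lt_one₀ (zero_lt_iff.mpr hvπ0) hπ1 ?_
    have := Int.self_le_toNat m
    omega
  calc O.valuation π ^ (m.toNat + 1) = O.valuation π ^ ((m.toNat : ℤ) + 1) := by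
        rw [← zpow_natCast]; push_cast; rfl
    _ < O.valuation π ^ m := hlt1

/-- The side condition of `ZenoLU` (finite thinness) is never met on a discrete rank-one valuation.
[folklore] -/
theorem zeno_vacuous_of_discrete (O : ValuationSubring K) (R : ℕ → Subring K)
    (hdisc : ∃ π : K, π ≠ 0 ∧ O.valuation π < 1 ∧ ∀ z : K, z ≠ 0 → ∃ n : ℤ,
      O.valuation z = O.valuation π ^ n) {p : ℕ} {t : K} :
    ¬ (¬ InfiniteThinness O R ∧ ∃ s : ℕ → K, IsTorsorRun O R t p s) :=
  fun h => h.1 (infiniteThinness_of_discrete O R hdisc)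

/-- **THE LAW `EternalLU ↔ ZenoLU`.**  (→) restriction.  (←) Let `(A₀, t)` carry an eternal strict run
`s` along the base sequence `R`.  If `R` has finite thinness, `ZenoLU` applies.  If `R` is infinitely thin:
either `tᵖ` is a `p`-th power in `R 0 = (A₀)_𝔭` — then the BIRATIONAL EXIT (tree `stub_birationalExit`,
transported along `R 0 ≃ (A₀)_𝔭`, `PfaffLine.exists_ringEquiv_atPrime`) gives the conclusion —, or it is
not, and then some `δ ∈ Der_ℤ(R 0)` has `δ(tᵖ) ≠ 0` (`PfaffLine.exists_derivation_apply_ne_zero` over the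
presentation of `R 0` supplied by `PfaffLine.sequence_schema_of_ringHom`), so the Jacobian value budget
forbids an eternal run (`SteerRankThinness.not_isTorsorRun_of_infiniteThinness`) — contradiction. [folklore]
(Sources: HeinzerEtAl2015, Prop. 4.4.) -/
theorem eternalLU_iff_zenoLU : EternalLU ↔ ZenoLU := by
  constructor
  · intro hE p hp k K _ _ _ _ O A₀ h₀ t hfg htp hfr hreg hcs hz
    obtain ⟨R, hbase, -, s, hrun⟩ := hz
    exact hE p hp k K O A₀ h₀ t hfg htp hfr hreg hcs ⟨R, hbase, s, hrun⟩
  · intro hZ p hp k K _ _ _ _ O A₀ h₀ t hfg htp hfr hreg hcs het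
    obtain ⟨R, ⟨hR0, hRq⟩, s, hrun⟩ := het
    classical
    haveI := Fact.mk hp
    haveI : CharP K p := charP_of_injective_algebraMap (algebraMap k K).injective p
    by_cases hthin : InfiniteThinness O R
    swap
    · exact hZ p hp k K O A₀ h₀ t hfg htp hfr hreg hcs ⟨R, ⟨hR0, hRq⟩, hthin, s, hrun⟩
    -- infinite thinness: no eternal run unless the radicand is a `p`-th power at the centre
    have ht0 : t ^ p ∈ R 0 := by
      rw [hR0]
      exact le_locAtCentre A₀.toSubring O htp
    have hRO : ∀ i, R i ≤ O.toSubring := by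
      intro i
      cases i with
      | zero => rw [hR0]; exact locAtCentre_le h₀
      | succ i => exact (hRq i).target_le
    have hid : A₀.toSubring ≤ (RingHom.id K).range := fun x _ => RingHom.mem_range.mpr ⟨x, rfl⟩
    by_cases hpow : ∃ c : R 0, (⟨t ^ p, ht0⟩ : R 0) = c ^ p
    · -- the birational exit, transported along `R 0 ≃ (A₀)_𝔭`
      obtain ⟨c, hc⟩ := hpow
      have hR0c : (locAtCentre A₀.toSubring O).comap (RingHom.id K) = R 0 := by
        rw [hR0]
        ext x
        rfl
      obtain ⟨e₀, he₀⟩ := PfaffLine.exists_ringEquiv_atPrime (RingHom.id K) O A₀.toSubring h₀ hid hR0c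
      refine PfaffLine.stub_birationalExit p hp k K O A₀ h₀ t hfg htp hfr hreg ⟨e₀ c, ?_⟩
      rw [← map_pow, ← hc]
      exact (he₀ ⟨t ^ p, ht0⟩ htp).symm
    · -- a derivation of `R 0` seeing the radicand, then the budget
      push Not at hpow
      have hO : O.comap (RingHom.id K) = O := by
        ext x
        rfl
      have hS : A₀.toSubring.comap (RingHom.id K) = A₀.toSubring := by
        ext x
        rfl
      obtain ⟨hreg0, -, -, m, 𝔮, h𝔮, Φq, hΦq⟩ := PfaffLine.sequence_schema_of_ringHom p (RingHom.id K)
        O A₀ h₀ hfg hreg hid (R := R) (by rw [hO, hS]; exact hR0) (by rw [hO]; exact hRq) 0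
      haveI := hreg0
      haveI := h𝔮
      obtain ⟨δ, hδ⟩ := PfaffLine.exists_derivation_apply_ne_zero hp 𝔮 Φq hΦq hpow
      exact absurd hrun (not_isTorsorRun_of_infiniteThinness p O R hRO hRq hthin t ht0
        ⟨δ, fun h => hδ (Subtype.ext h)⟩ s)

/-! ## 7. The kernel and the route-level deciding theorem -/

/-- **KERNEL `LuAlphaPTorsor ↔ StallStartLU ∧ ZenoLU`.**  (→) restrictions.  (←) the tree anchor
`PfaffLine.luAlphaPTorsor_iff_defectCoreFinal` reduces the host to its defect core F⁹ (closed centre,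
zero-dimensional, base dimension `≥ 3`, non-Abhyankar, non-dense, non-discrete, no unit derivative, not a
`p`-th power); there the tree trichotomy `SwitchingDichotomy.stub_core4RunTrichotomy` splits the datum into
ETERNAL (the law `eternalLU_iff_zenoLU`, then `ZenoLU`), ORDER-ONE (decided, `orderOne_concl`) and STALL
(`stallLU_iff_stallStartLU`, then `StallStartLU`), the defect-core side `CoreSide` passing unchanged to the
rebased datum.  Axioms: propext, Classical.choice, Quot.sound. [folklore] (Sources: KnafKuhlmann2009, Thm. 1.5.) -/
theorem luAlphaPTorsor_iff_thinnessCut : Valuative.LuAlphaPTorsor ↔ (StallStartLU ∧ ZenoLU) := by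
  constructor
  · intro h
    exact ⟨(pieces_of_luAlphaPTorsor h).1, (pieces_of_luAlphaPTorsor h).2.2.2⟩
  · rintro ⟨hT, hZ⟩
    refine PfaffLine.luAlphaPTorsor_iff_defectCoreFinal.mpr ?_
    intro p hp k K _ _ _ _ O A₀ h₀ t hfg htp hfr hreg _hmax hzd hdim2 hAK hnd hdisc _hδ _hpow
    classical
    have hcs : CoreSide k K O := ⟨hzd, hAK, hnd, hdisc⟩
    obtain ⟨R, hR0, hRq, h3⟩ :=
      SwitchingDichotomy.stub_core4RunTrichotomy p k K O A₀ h₀ t htp hreg hdim2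
    rcases h3 with ⟨s, hrun⟩ | ⟨s, N, hrun, hone⟩ | ⟨s, N, hrun, hcan, hone⟩
    · exact (eternalLU_iff_zenoLU.mpr hZ) p hp k K O A₀ h₀ t hfg htp hfr hreg hcs
        ⟨R, ⟨hR0, hRq⟩, s, hrun⟩
    · exact orderOne_concl p hp k K O A₀ h₀ t hfg htp hfr hreg ⟨hR0, hRq⟩ hrun hone
    · exact (stallLU_iff_stallStartLU.mpr hT) p hp k K O A₀ h₀ t hfg htp hfr hreg hcs
        ⟨R, ⟨hR0, hRq⟩, s, N, hrun, hcan, hone⟩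

/-- The two g12 pieces give back the host (one direction of the kernel, for the writer). (ours) [folklore] -/
theorem luAlphaPTorsor_of_pieces (hT : StallStartLU) (hZ : ZenoLU) : Valuative.LuAlphaPTorsor :=
  luAlphaPTorsor_iff_thinnessCut.mpr ⟨hT, hZ⟩

/-! ## 8. The ORDER AXIS at the base (g11's `TameOrderCore` range, re-derived at stage 0 with proofs)

A stall is an ORDER condition on the `p`-th-power shifts `tᵖ − gᵖ`, `g ∈ (A₀)_𝔭`, of the radicand:
order `≥ p` (the shift lies in `𝔪ᵖ`, KANGAROO) gives a strict step (`canStep_of_mem_pow`), order exactly `1`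
(`𝔪 ∖ 𝔪²`) gives order-one form (`orderOneAt_of_mem_of_not_mem_sq`); so a stalled datum is ORDER-TAME:
every shift is a unit (order `0`, INERT residue extension) or lies in `𝔪² ∖ 𝔪ᵖ` (order `2 … p−1`).  The piece
`TameStartLU` below is the host on that class, stated on the local ring `locAtCentre A₀ O` alone (no sequence),
and `stallStartLU_of_tameStartLU : TameStartLU → StallStartLU` puts it in the kernel
(`luAlphaPTorsor_iff_tameCut`). -/

/-- `𝔪ⁿ / xⁿ ⊆ S[𝔪/x]`: an element of `𝔪ⁿ` divided by `xⁿ` lies in the blow-up ring. [folklore] -/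
theorem div_pow_mem_blowupRing {S : Subring K} [IsLocalRing S] (x : K) :
    ∀ (n : ℕ) (z : S), z ∈ maximalIdeal S ^ n → (z : K) / x ^ n ∈ blowupRing S x := by
  intro n
  induction n with
  | zero =>
    intro z _
    rw [pow_zero, div_one]
    exact le_blowupRing S x z.2
  | succ n ih =>
    intro z hz
    rw [pow_succ] at hz
    refine Submodule.mul_induction_on hz (fun a ha b hb => ?_) (fun a b ha hb => ?_)
    · have hab : ((a * b : S) : K) / x ^ (n + 1) = ((a : K) / x ^ n) * ((b : K) / x) := by
        rw [Subring.coe_mul, pow_succ, div_mul_div_comm]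
      rw [hab]
      exact Subring.mul_mem _ (ih a ha) (div_mem_blowupRing x hb)
    · rw [Subring.coe_add, add_div]
      exact Subring.add_mem _ ha hb

/-- **Order `≥ p` is KANGAROO: a shift in `𝔪ᵖ` gives a strict step.**  If `S₁` is the quadratic transform
of `S` along `O` (exceptional parameter `x`, `S₁ ⊇ S[𝔪/x]`) and `uᵖ − gᵖ ∈ 𝔪_Sᵖ` for some `g ∈ S`, then
`s' := (u − g)/x` is a strict transform of `u` with `s'ᵖ = (uᵖ − gᵖ)/xᵖ ∈ S₁`. [folklore] -/
theorem exists_strictStep_of_mem_pow (p : ℕ) [Fact p.Prime] [CharP K p] (O : ValuationSubring K)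
    {S S₁ : Subring K} [IsLocalRing S] (hq : IsQuadraticTransformAlong O S S₁)
    (hdom : SubringDominates S O.toSubring) (u : K) {g : K} (hg : g ∈ S) (hm : u ^ p - g ^ p ∈ S)
    (hpow : (⟨u ^ p - g ^ p, hm⟩ : S) ∈ maximalIdeal S ^ p) :
    ∃ s' : K, IsStrictStep O S u s' ∧ s' ^ p ∈ S₁ := by
  obtain ⟨_, x, hxm, hx0, hxmax, hS₁⟩ := hq.exists_eq_locAtCentre
  have hx0K : ((x : S) : K) ≠ 0 := fun e => hx0 (Subtype.ext e)
  have hval := (subringDominates_valuationSubring_iff hdom.1).mp hdom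
  refine ⟨(u - g) / x, ⟨x, g, ⟨x.2, hx0K, (hval x).mp hxm, fun y hy hvy => ?_⟩, hg, ?_⟩, ?_⟩
  · exact hxmax ⟨y, hy⟩ ((hval ⟨y, hy⟩).mpr hvy)
  · rw [mul_div_cancel₀ _ hx0K, sub_add_cancel]
  · rw [div_pow, sub_pow_char, hS₁]
    exact le_locAtCentre _ O (div_pow_mem_blowupRing (x : K) p ⟨u ^ p - g ^ p, hm⟩ hpow)

/-- Hence a shift in `𝔪ᵖ` at stage `N` makes the run steppable (`CanStep`). [folklore] -/
theorem canStep_of_mem_pow (p : ℕ) [Fact p.Prime] [CharP K p] (O : ValuationSubring K)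
    (R : ℕ → Subring K) (N : ℕ) [IsLocalRing (R N)] (hq : IsQuadraticTransformAlong O (R N) (R (N + 1)))
    (hdom : SubringDominates (R N) O.toSubring) (s : ℕ → K) {g : K} (hg : g ∈ R N)
    (hm : s N ^ p - g ^ p ∈ R N) (hpow : (⟨s N ^ p - g ^ p, hm⟩ : R N) ∈ maximalIdeal (R N) ^ p) :
    CanStep O R p s N :=
  exists_strictStep_of_mem_pow p O hq hdom (s N) hg hm hpow

/-- **Order exactly `1` is ORDER-ONE FORM**: in a regular local ring an element of `𝔪 ∖ 𝔪²` is a one-element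
part of a regular system of parameters (`PfaffLine.exists_rsop_cons`). (Sources: Matsumura1987, Thm. 14.2.) -/
theorem orderOneAt_of_mem_of_not_mem_sq {S : Subring K} [IsRegularLocalRing S] (p : ℕ) (u : K) {g : K}
    (hg : g ∈ S) (hm : u ^ p - g ^ p ∈ S) (h1 : (⟨u ^ p - g ^ p, hm⟩ : S) ∈ maximalIdeal S)
    (h2 : (⟨u ^ p - g ^ p, hm⟩ : S) ∉ maximalIdeal S ^ 2) : OrderOneAt S p u := by
  obtain ⟨d, w, hw0, hwspan, hdim⟩ := PfaffLine.exists_rsop_cons (L := S) ⟨u ^ p - g ^ p, hm⟩ h1 h2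
  refine ⟨g, hg, inferInstance, fun _ => ⟨u ^ p - g ^ p, hm⟩,
    ⟨‹IsRegularLocalRing S›, d, fun j => w j.succ, ?_, ?_⟩, rfl⟩
  · rw [hdim, Nat.add_comm]
  · rw [← hwspan]
    congr 1
    ext a
    simp only [Set.mem_union, Set.mem_range, Fin.exists_fin_succ, hw0, exists_const]

/-- **Piece T′ — `TameStartLU`** [WEAKER · UNDECIDED · ATTACKABLE-L; the ORDER-AXIS form of piece T].
Relative local uniformization of the torsor for a core-side datum that is ORDER-TAME AT ITS BASE: in the local
ring `(A₀)_𝔭 = locAtCentre A₀ O` every `p`-th-power shift `tᵖ − gᵖ` of the radicand is a UNIT (order `0`: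
the residue of `tᵖ` is not a `p`-th power — inert, only over imperfect residue fields) or lies in `𝔪² ∖ 𝔪ᵖ`
(order `2, …, p−1`).  This is g11's `TameOrderCoreLU` range (critic row 98: NECESSARY · UNDECIDED · WEAKER ·
ATTACKABLE-L, law E2 = multiplicity `< p` ⇒ maximal contact, Kollár 2007 Aside 3.57) together with the inert
order-`0` class, now placed at stage `0` of the run by PROOF (`stallStartLU_of_tameStartLU`).  Why it might
fail: E2 needs the torsor-shaped coefficient ideal over a base of dimension one less to be monomializable along
a non-Abhyankar valuation (`DimensionFourFrontier`); the inert class needs sandwiched LU of the base. (ours) -/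
def TameStartLU : Prop :=
  ∀ p : ℕ, p.Prime → ∀ (k K : Type) [Field k] [CharP k p] [Field K] [Algebra k K]
    (O : ValuationSubring K) (A₀ : Subalgebra k K) (h₀ : A₀.toSubring ≤ O.toSubring) (t : K),
    A₀.FG → ∀ (htp : t ^ p ∈ A₀), IsFractionRing (Algebra.adjoin k (insert t (A₀ : Set K))) K →
    IsRegularLocalRing (Localization.AtPrime (Ideal.comap (Subring.inclusion h₀) (maximalIdeal O))) →
    CoreSide k K O →
    (∀ (g : K) (hg : g ∈ locAtCentre A₀.toSubring O),
      haveI := isLocalRing_locAtCentre (B := A₀.toSubring) (O := O) h₀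
      IsUnit (⟨t ^ p - g ^ p, Subring.sub_mem _ (le_locAtCentre A₀.toSubring O htp)
          (Subring.pow_mem _ hg p)⟩ : locAtCentre A₀.toSubring O) ∨
        ((⟨t ^ p - g ^ p, Subring.sub_mem _ (le_locAtCentre A₀.toSubring O htp)
            (Subring.pow_mem _ hg p)⟩ : locAtCentre A₀.toSubring O) ∈
            maximalIdeal (locAtCentre A₀.toSubring O) ^ 2 ∧
          (⟨t ^ p - g ^ p, Subring.sub_mem _ (le_locAtCentre A₀.toSubring O htp)
            (Subring.pow_mem _ hg p)⟩ : locAtCentre A₀.toSubring O) ∉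
            maximalIdeal (locAtCentre A₀.toSubring O) ^ p)) →
    Concl O A₀ t

/-- `0641 ⟹ TameStartLU` (restriction). (ours) [folklore] -/
theorem tameStartLU_of_luAlphaPTorsor (h : Valuative.LuAlphaPTorsor) : TameStartLU :=
  fun p hp k K _ _ _ _ O A₀ h₀ t hfg htp hfr hreg _ _ => h p hp k K O A₀ h₀ t hfg htp hfr hreg

/-- The ORDER-TAME hypothesis of piece T′ for one datum (every shift `tᵖ − gᵖ`, `g ∈ (A₀)_𝔭`, is a unit
or lies in `𝔪² ∖ 𝔪ᵖ`), as a named predicate so that pointwise statements can refer to it. (ours) -/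
def TameHyp {k K : Type} [Field k] [Field K] [Algebra k K] (p : ℕ) (O : ValuationSubring K)
    (A₀ : Subalgebra k K) (h₀ : A₀.toSubring ≤ O.toSubring) (t : K) (htp : t ^ p ∈ A₀) : Prop :=
  ∀ (g : K) (hg : g ∈ locAtCentre A₀.toSubring O),
    haveI := isLocalRing_locAtCentre (B := A₀.toSubring) (O := O) h₀
    IsUnit (⟨t ^ p - g ^ p, Subring.sub_mem _ (le_locAtCentre A₀.toSubring O htp)
        (Subring.pow_mem _ hg p)⟩ : locAtCentre A₀.toSubring O) ∨
      ((⟨t ^ p - g ^ p, Subring.sub_mem _ (le_locAtCentre A₀.toSubring O htp)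
          (Subring.pow_mem _ hg p)⟩ : locAtCentre A₀.toSubring O) ∈
          maximalIdeal (locAtCentre A₀.toSubring O) ^ 2 ∧
        (⟨t ^ p - g ^ p, Subring.sub_mem _ (le_locAtCentre A₀.toSubring O htp)
          (Subring.pow_mem _ hg p)⟩ : locAtCentre A₀.toSubring O) ∉
          maximalIdeal (locAtCentre A₀.toSubring O) ^ p)

/-- `TameStartLU` is literally `… → TameHyp p O A₀ h₀ t htp → Concl O A₀ t`. (ours) [folklore] -/
theorem tameStartLU_iff : TameStartLU ↔
    ∀ p : ℕ, p.Prime → ∀ (k K : Type) [Field k] [CharP k p] [Field K] [Algebra k K]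
      (O : ValuationSubring K) (A₀ : Subalgebra k K) (h₀ : A₀.toSubring ≤ O.toSubring) (t : K),
      A₀.FG → ∀ (htp : t ^ p ∈ A₀), IsFractionRing (Algebra.adjoin k (insert t (A₀ : Set K))) K →
      IsRegularLocalRing (Localization.AtPrime (Ideal.comap (Subring.inclusion h₀) (maximalIdeal O))) →
      CoreSide k K O → TameHyp p O A₀ h₀ t htp → Concl O A₀ t :=
  Iff.rfl

/-- **POINTWISE: a datum stalled at its base is order-tame at its base** (order `≥ p` would step,
`exists_strictStep_of_mem_pow`; order `1` would be order-one form, `orderOneAt_of_mem_of_not_mem_sq`). [folklore] -/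
theorem tameHyp_of_stalled {k K : Type} [Field k] [Field K] [Algebra k K] (p : ℕ) (hp : p.Prime)
    [CharP k p] (O : ValuationSubring K) (A₀ : Subalgebra k K) (h₀ : A₀.toSubring ≤ O.toSubring) (t : K)
    (htp : t ^ p ∈ A₀)
    (hreg : IsRegularLocalRing (Localization.AtPrime (Ideal.comap (Subring.inclusion h₀) (maximalIdeal O))))
    (R : ℕ → Subring K) (hR : IsBaseSequence O A₀ R) (hcan : ¬ CanStep O R p (fun _ => t) 0)
    (hone : ¬ OrderOneAt (R 0) p t) : TameHyp p O A₀ h₀ t htp := by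
  obtain ⟨hR0, hRq⟩ := hR
  classical
  haveI := Fact.mk hp
  haveI : CharP K p := charP_of_injective_algebraMap (algebraMap k K).injective p
  haveI hloc : IsLocalRing (locAtCentre A₀.toSubring O) := isLocalRing_locAtCentre h₀
  haveI hregL : IsRegularLocalRing (locAtCentre A₀.toSubring O) :=
    (isRegularLocalRing_locAtCentre_iff h₀).mpr hreg
  have hdom : SubringDominates (locAtCentre A₀.toSubring O) O.toSubring := subringDominates_locAtCentre h₀
  have hq : IsQuadraticTransformAlong O (locAtCentre A₀.toSubring O) (R 1) := by
    rw [← hR0]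
    exact hRq 0
  rw [hR0] at hone
  intro g hg
  set m : locAtCentre A₀.toSubring O := ⟨t ^ p - g ^ p, Subring.sub_mem _
    (le_locAtCentre A₀.toSubring O htp) (Subring.pow_mem _ hg p)⟩ with hm
  by_cases hu : IsUnit m
  · exact Or.inl hu
  have h1 : m ∈ maximalIdeal (locAtCentre A₀.toSubring O) := hu
  refine Or.inr ⟨?_, fun hpw => ?_⟩
  · by_contra h2
    exact hone (orderOneAt_of_mem_of_not_mem_sq p t hg m.2 h1 h2)
  · apply hcan
    show ∃ s' : K, IsStrictStep O (R 0) t s' ∧ s' ^ p ∈ R (0 + 1)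
    rw [hR0]
    exact exists_strictStep_of_mem_pow p O hq hdom t hg m.2 hpw

/-- **`TameStartLU → StallStartLU`** (the order-tame class contains the stalled class, pointwise
`tameHyp_of_stalled`). [folklore] -/
theorem stallStartLU_of_tameStartLU (hTm : TameStartLU) : StallStartLU := by
  intro p hp k K _ _ _ _ O A₀ h₀ t hfg htp hfr hreg hcs hst
  obtain ⟨R, hR, hcan, hone⟩ := hst
  exact hTm p hp k K O A₀ h₀ t hfg htp hfr hreg hcs
    (tameHyp_of_stalled p hp O A₀ h₀ t htp hreg R hR hcan hone)

/-- **KERNEL on the order axis: `LuAlphaPTorsor ↔ TameStartLU ∧ ZenoLU`.** [folklore] -/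
theorem luAlphaPTorsor_iff_tameCut : Valuative.LuAlphaPTorsor ↔ (TameStartLU ∧ ZenoLU) :=
  ⟨fun h => ⟨tameStartLU_of_luAlphaPTorsor h, (pieces_of_luAlphaPTorsor h).2.2.2⟩,
    fun h => luAlphaPTorsor_iff_thinnessCut.mpr ⟨stallStartLU_of_tameStartLU h.1, h.2⟩⟩


end Summit.ResolutionOfSingularities.ResolutionOfSingularities.Theorems.ThinnessCutClasses
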